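import Literature.IUT.HodgeTheaters.FrobenioidBridgeModelsWitness
import HarnessLib

/-!
# [IUTchI] Example 5.4 (vi) as typed (`S5Local.Ex54vi`) is independent of the stub `S5Local` — kernel certificate

Mochizuki, *Inter-universal Teichmüller theory I*, §5, Example 5.4 (vi) (kurims May-2020 manuscript
pp. 149–150): the restriction functors induced by a poly-morphism `†ℱ_⟨J⟩ → †ℱ^⊚` are "independent of the choice
of the poly-morphism … among its `F_l^⋇`-conjugates".  In `FrobenioidBridgeModels.lean` (abc-iut-L5-t3, p407134)
this is the named statement `S5Local.Ex54vi S`: `S.restrictionOf d X δ = S.restrictionOf d X δ'` for all `δ, δ'`,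
where `RestrictionDatum` and `restrictionOf` are FREE FIELDS of the local hypothesis structure `S5Local 𝔡`
(TODO-merge: the real restriction functors of Ex. 5.1 (vii) are abc-iut-L5-t1's `GlobalFrobenioids*` files).

This PROOF-ONLY-IN-SPIRIT companion (one variant model `def`, three theorems) certifies in the kernel what the L5
lead's ruling (HOME STATUS 2026-08-25T23:21:23Z (C)) and the w4-d066 survey state in prose: **`Ex54vi` is not
derivable from the interface** — it HOLDS on abc-iut-L5-t8's consistency inhabitant `toyS5Local`
(`FrobenioidBridgeModelsWitness.lean`: restriction data `PUnit`) and FAILS on the variant `toyS5LocalLab` that has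
the SAME data except that the restriction datum attached to `δ` is `δ` itself (two `F_5^⋇`-label classes differ).
Consequently the FACT-LIST row F-2000 (`Ex54vi`, «[IUTch] inside — prove or GAP») cannot be closed by a proof over
`S5Local`; its disposition is a RESTATEMENT of the consumer (a law field `restrictionOf_indep` on the stub, or the
adapter instantiating `restrictionOf` from the Example 5.1 data — abc-iut-L5-t1's FrobenioidBridgeModelsAdapter
row), exactly as for the Example 3.2 «FromF» family (w4-d047, `BadLocalFrobenioidClaimsIndependence.lean`).
Nothing here concerns the arithmetic model or takes a side on [IUTchIII] Cor. 3.12; record-only,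
[claim: Mochizuki2012, status: disputed]. Seat abc-iut-w4-d067 (WAVE-4, D-0067 cone bookkeeping).
-/

namespace Literature.IUT.HodgeTheaters

open CategoryTheory

namespace BaseThetaDatum

open TrivialModel

/-- **`Ex54vi` holds on the consistency inhabitant `toyS5Local`** (its restriction data are `PUnit`), so the typed
statement of Ex. 5.4 (vi) is satisfiable over the stub. ([IUTchI] Ex 5.4 (vi) p.149)
[claim: Mochizuki2012, status: disputed] -/
theorem ex54vi_toyS5Local : S5Local.Ex54vi toyS5Local :=
  fun _ _ _ _ _ _ => rfl

/-- The variant inhabitant `toyS5LocalLab` of `S5Local trivialModel`: identical to `toyS5Local` except that the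
restriction datum is the global label class itself — `RestrictionDatum := F_5^⋇` (= `LabCusp(†𝒟^⊚)` of the trivial
base model) and `restrictionOf d X δ := δ`.  All the printed LAWS of the stub are untouched (they do not mention the
two free fields). ([IUTchI] Ex 5.4 (vi) p.149) [claim: Mochizuki2012, status: disputed] -/
noncomputable def toyS5LocalLab : S5Local trivialModel :=
  { toyS5Local with
    RestrictionDatum := fun _ _ => FlStar 5
    restrictionOf := fun _ _ δ => δ }

/-- `F_5^⋇ = F_5^×/{±1}` has exactly two elements. ([IUTchI] §0 p.34) [claim: Mochizuki2012, status: disputed] -/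
theorem natCard_flStar_five : Nat.card (FlStar 5) = 2 := by
  haveI : Fact (Nat.Prime 5) := ⟨Nat.prime_five⟩
  rw [card_flStar 5 (by decide)]
  decide

/-- **`Ex54vi` FAILS on `toyS5LocalLab`**: the two distinct label classes `δ ≠ δ'` of `F_5^⋇` give distinct
restriction data for the same poly-morphism data `(Y, Z, d, X)`. ([IUTchI] Ex 5.4 (vi) p.149)
[claim: Mochizuki2012, status: disputed] -/
theorem not_ex54vi_toyS5LocalLab : ¬ S5Local.Ex54vi toyS5LocalLab := by
  intro h
  haveI : Finite (FlStar 5) := Nat.finite_of_card_ne_zero (by rw [natCard_flStar_five]; decide)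
  have hnt : Nontrivial (FlStar 5) :=
    Finite.one_lt_card_iff_nontrivial.mp (by rw [natCard_flStar_five]; decide)
  obtain ⟨a, b, hab⟩ := hnt
  exact hab (h (SingleObj.star (FlStar 5)) (SingleObj.star (FlStar 5)) PUnit.unit
    (fun _ => SingleObj.star (Multiplicative ℕ)) a b)

/-- **Independence certificate for F-2000 `Ex54vi`**: the typed Example 5.4 (vi) holds on one inhabitant of the
stub `S5Local trivialModel` and fails on another — it is NOT a consequence of the interface, hence not a proof debt
over `S5Local` but a restatement item (law field / adapter), cf. the module docstring.
([IUTchI] Ex 5.4 (vi) p.149) [claim: Mochizuki2012, status: disputed] -/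
theorem ex54vi_independent :
    S5Local.Ex54vi toyS5Local ∧ ¬ S5Local.Ex54vi toyS5LocalLab :=
  ⟨ex54vi_toyS5Local, not_ex54vi_toyS5LocalLab⟩

end BaseThetaDatum

end Literature.IUT.HodgeTheaters
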